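import Summits.QuantumAdvantage.AdviceFreeQNC0.GradedSeeds38ReductionS
import HarnessLib

/-!
# Cell qa-qnc0, `p = 3` — the structured branch needs only the LINEAR case of (R1)  (planner qa-qnc0-p1 g39, ROUND-38 §2)

The open analytic input of the structured branch of `(J3)_{r=1}` is (R1) `TwistedJunta36.TwistedJuntaBoundX3S ρ`
(tree `GradedSeeds38ReductionS.lean`): twisted win-sums of ARBITRARY `W`-tolerant polylog-JUNTA strategies.  But the
strategies the structured branch actually meets are not arbitrary juntas: after Lemma S (`perOutputForms_span` /
`exists_gradedSeeds`) every private form is `ℓ_k = (seed combination) + r_k` with a remainder `r_k` having `≤ (log₂N)^C`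
non-zero coefficients outside the tolerance set `W`; freezing the seed residues `v`, output `k` is a function of the
single sparse 𝔽₃-LINEAR FORM `⟨r_k, x⟩`.  This file

* types (R1-lin) `TwistedLinBoundX3S ρ` — (R1) restricted to bells `φ_k(⟨r_k,x⟩ mod 3)`, `#(supp r_k ∖ W) ≤ (log₂N)^C`;
* proves it is WEAKER than (R1): `twistedLinBoundX3S_of_juntaS : TwistedJuntaBoundX3S ρ → TwistedLinBoundX3S ρ`;
* types the structured-branch conclusion for seed ⊕ sparse-LINEAR-remainder strategies, `SeedLinHardXS α`, and proves the
  reduction `gradedLinReductionS : ∀ ρ α, 0 ≤ ρ → 3ρ^α < 1 → TwistedLinBoundX3S ρ → SeedLinHardXS α`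
  (the proof of `gradedJuntaReductionS` with the hypothesis applied to linear bells only; main term still
  `AffBells34.coverPolylogHard`, since a sparse linear bell is a junta);
* records the instantiation to per-output forms `ℓ_k = Σ_j a_{kj} c_j + r_k` (`perOutputForms_seedSparse`).

WHY THE RE-TYPING MATTERS (ROUND-38 §2–§4): linear bells are LIVENESS-BLIND — a bell `φ(⟨r,x⟩)` at position `k ≫ #supp r`
carries exponentially little information about its own walk residue `W_k mod 3` — whereas general juntas at positions
`k < (log₂N)^C` read the prefix and KNOW their residue, which is what the shared-liveness coalitions of K-39A exploit
(per fully twisted payload block `2/3` instead of the speakers' `4/9`).  (R1-lin) is the statement a proof should target.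

WHAT THIS IS NOT: (R1-lin) is OPEN (a conjecture); crux 22907 untouched; no ledger item (D-0168 custody).
-/

noncomputable section

namespace Summit.QuantumAdvantage.AdviceFreeQNC0

open Finset Literature.Computability.QuantumComplexity Literature.Computability.MetaComplexity

namespace LinJunta39

open TwistedJunta36 GradedSeeds38

/-- The value `⟨r, x⟩ mod 3` of the 𝔽₃-form `r` at the Boolean point `x`. -/
def linVal {N : ℕ} (r : Fin N → ZMod 3) (x : Fin N → Bool) : ZMod 3 := ∑ i, if x i then r i else 0

/-- The support of the form `r` OUTSIDE the tolerance set `W` (same expression as in `TwistedJuntaBoundX3S`). -/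
def suppOff {N : ℕ} (W : Finset (Fin N)) (r : Fin N → ZMod 3) : Finset (Fin N) :=
  univ.filter fun i : Fin N => i ∉ W ∧ r i ≠ 0

/-- auxiliary lemma `linVal_congr` (planner p1 g39, exp39; ported verbatim). -/
theorem linVal_congr {N : ℕ} (r : Fin N → ZMod 3) {x x' : Fin N → Bool} (h : ∀ i, r i ≠ 0 → x i = x' i) :
    linVal r x = linVal r x' := by
  unfold linVal
  refine Finset.sum_congr rfl fun i _ => ?_
  by_cases hi : r i = 0
  · simp [hi]
  · rw [h i hi]

/-- auxiliary lemma `sdiff_suppOff_union_subset` (planner p1 g39, exp39; ported verbatim). -/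
theorem sdiff_suppOff_union_subset {N : ℕ} (W : Finset (Fin N)) (r : Fin N → ZMod 3) :
    (suppOff W r ∪ W) \ W ⊆ suppOff W r := by
  intro i hi
  simp only [mem_sdiff, mem_union] at hi
  rcases hi with ⟨h1 | h1, h2⟩
  · exact h1
  · exact absurd h1 h2

/-- auxiliary lemma `mem_suppOff_union` (planner p1 g39, exp39; ported verbatim). -/
theorem mem_suppOff_union {N : ℕ} (W : Finset (Fin N)) (r : Fin N → ZMod 3) {i : Fin N} (hi : r i ≠ 0) :
    i ∈ suppOff W r ∪ W := by
  by_cases hW : i ∈ W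
  · exact mem_union_right _ hW
  · exact mem_union_left _ (by simp [suppOff, hW, hi])

/-- A sparse linear bell is a `(suppOff W r ∪ W)`-junta. -/
theorem linVal_readsOnly {N : ℕ} (W : Finset (Fin N)) (r : Fin N → ZMod 3) (x x' : Fin N → Bool)
    (h : ∀ i ∈ suppOff W r ∪ W, x i = x' i) : linVal r x = linVal r x' :=
  linVal_congr r fun i hi => h i (mem_suppOff_union W r hi)

/-- **(R1-lin) — the LINEAR case of the size-normalised twisted junta bound (R1).**  Bells `φ_k(⟨r_k,x⟩ mod 3)` with
`#(supp r_k ∖ W) ≤ (log₂N)^C`, `3|W| ≤ N`; exponent `#(supp β ∖ W)/(log₂N)^C`.  OPEN (conjecture; ROUND-38 §2). -/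
def TwistedLinBoundX3S (ρ : ℝ) : Prop :=
  open scoped Classical in
  ∀ C : ℕ, ∃ A n₀ : ℕ, ∀ N ≥ n₀,
    ∀ (W : Finset (Fin N)) (r : Fin N → Fin N → ZMod 3) (φ : Fin N → ZMod 3 → Bool),
      3 * W.card ≤ N → (∀ k, (suppOff W (r k)).card ≤ (Nat.log 2 N) ^ C) →
        ∀ β : Fin N → ZMod 3,
          ‖∑ x : Fin N → Bool, (ZMod.stdAddChar (∑ i : Fin N, if x i then β i else 0) : ℂ) *
              (if (OddZeros x ∧ RingHLF.Rel x (fun k => φ k (linVal (r k) x))) then (1 : ℂ) else 0)‖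
            ≤ (N : ℝ) ^ A * ρ ^ ((suppOff W β).card / (Nat.log 2 N) ^ C) * (2 : ℝ) ^ N

/-- **(R1) ⇒ (R1-lin)**: the linear case is weaker (a sparse linear bell is a `W`-tolerant sparse junta). -/
theorem twistedLinBoundX3S_of_juntaS {ρ : ℝ} (h : TwistedJuntaBoundX3S ρ) : TwistedLinBoundX3S ρ := by
  classical
  intro C
  obtain ⟨A, n₀, hA⟩ := h C
  refine ⟨A, n₀, fun N hN W r φ hW hr β => ?_⟩
  have hT : ∀ k, ((suppOff W (r k) ∪ W) \ W).card ≤ (Nat.log 2 N) ^ C := fun k =>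
    (card_le_card (sdiff_suppOff_union_subset W (r k))).trans (hr k)
  have hg : ∀ k (x x' : Fin N → Bool), (∀ i ∈ suppOff W (r k) ∪ W, x i = x' i) →
      φ k (linVal (r k) x) = φ k (linVal (r k) x') := fun k x x' hxx' => by
    rw [linVal_readsOnly W (r k) x x' hxx']
  exact hA N hN W (fun k => suppOff W (r k) ∪ W) (fun k x => φ k (linVal (r k) x)) hW hT hg β

/-- **The structured branch for seed ⊕ sparse-LINEAR-remainder strategies** (inflated schedule as in `SeedJuntaHardXS`):
outputs `F k (seed residues) (⟨r_k,x⟩)` with `#(supp r_k ∖ W) ≤ (log₂N)^C`, `3|W| ≤ N`, seeds graded-spread outside `W`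
with schedule `(log₂N)^C·(α(j+1) + D·log₂N)`: such strategies win on `≤ θ·2^{N−1}` odd inputs, one `θ < 1`. -/
def SeedLinHardXS (α : ℕ) : Prop :=
  open scoped Classical in
  ∃ θ : ℝ, θ < 1 ∧ ∀ C : ℕ, ∃ D n₀ : ℕ, ∀ N ≥ n₀,
    ∀ (W : Finset (Fin N)) (R : ℕ) (c : Fin R → Fin N → ZMod 3) (r : Fin N → Fin N → ZMod 3)
      (F : Fin N → (Fin R → ZMod 3) → ZMod 3 → Bool),
      3 * W.card ≤ N → GradedSpreadOff W c (fun j => (Nat.log 2 N) ^ C * (α * (j.val + 1) + D * Nat.log 2 N)) →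
      (∀ k, (suppOff W (r k)).card ≤ (Nat.log 2 N) ^ C) →
        ((univ.filter fun x : Fin N → Bool =>
            OddZeros x ∧ RingHLF.Rel x (fun k => F k (LinForms.resVec c x) (linVal (r k) x))).card : ℝ)
          ≤ θ * (2 : ℝ) ^ (N - 1)

/-- `SeedJuntaHardXS α ⇒ SeedLinHardXS α` (sanity: the linear class is contained in the junta class). -/
theorem seedLinHardXS_of_juntaXS {α : ℕ} (h : SeedJuntaHardXS α) : SeedLinHardXS α := by
  classical
  obtain ⟨θ, hθ, hall⟩ := h
  refine ⟨θ, hθ, fun C => ?_⟩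
  obtain ⟨D, n₀, hD⟩ := hall C
  refine ⟨D, n₀, fun N hN W R c r F hW hspread hr => ?_⟩
  have hT : ∀ k, ((suppOff W (r k) ∪ W) \ W).card ≤ (Nat.log 2 N) ^ C := fun k =>
    (card_le_card (sdiff_suppOff_union_subset W (r k))).trans (hr k)
  have hH : ∀ k (v : Fin R → ZMod 3) (x x' : Fin N → Bool), (∀ i ∈ suppOff W (r k) ∪ W, x i = x' i) →
      F k v (linVal (r k) x) = F k v (linVal (r k) x') := fun k v x x' hxx' => by
    rw [linVal_readsOnly W (r k) x x' hxx']
  exact hD N hN W R c (fun k => suppOff W (r k) ∪ W) (fun k v x => F k v (linVal (r k) x)) hW hspread hT hH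

/-- **TARGET `GradedLinReductionS`**: (R1-lin) transfers junta hardness to all seed ⊕ sparse-linear strategies. -/
def GradedLinReductionS : Prop :=
  ∀ (ρ : ℝ) (α : ℕ), 0 ≤ ρ → 3 * ρ ^ α < 1 → TwistedLinBoundX3S ρ → SeedLinHardXS α

section ReductionS

open scoped Classical in
/-- **`gradedLinReductionS : GradedLinReductionS` — PROVED** (the proof of `gradedJuntaReductionS`, with the twisted
bound applied to the frozen-seed LINEAR bells `t ↦ F k v t` on the forms `r k`; the main term is still
`AffBells34.coverPolylogHard` because `x ↦ F k v (⟨r_k,x⟩)` is a `(suppOff W r_k ∪ W)`-junta). -/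
theorem gradedLinReductionS : GradedLinReductionS := by
  classical
  intro ρ α hρ hq hTJ
  obtain ⟨θ, hθ, hcover⟩ := AffBells34.coverPolylogHard
  refine ⟨(1 + θ) / 2, by linarith, fun C => ?_⟩
  obtain ⟨n₁, hn₁⟩ := hcover C
  obtain ⟨A, n₂, hn₂⟩ := hTJ C
  -- the ratio `q = 3ρ^α ∈ [0,1)` and `ρ^α ≤ 1/2`, `ρ ≤ 1`
  have hρα0 : 0 ≤ ρ ^ α := pow_nonneg hρ α
  have hq0 : 0 ≤ 3 * ρ ^ α := by positivity
  have hρα : ρ ^ α ≤ 1 / 2 := by linarith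
  have hρ1 : ρ ≤ 1 := by
    by_contra h
    have h1 : 1 ≤ ρ ^ α := one_le_pow₀ (le_of_lt (not_le.1 h))
    linarith
  have h1θ : 0 < (1 - θ) / 2 := by linarith
  -- the error constant
  obtain ⟨n₃, hn₃⟩ : ∃ n₃ : ℕ, (2 : ℝ) ^ (A + 2) * (3 * ρ ^ α / (1 - 3 * ρ ^ α)) / ((1 - θ) / 2) ≤ n₃ :=
    ⟨_, Nat.le_ceil _⟩
  refine ⟨α * (A + 1), max (max n₁ n₂) (max n₃ 2), fun N hN W R c r F hW hspread hr => ?_⟩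
  have hN1 : n₁ ≤ N := le_trans (le_trans (le_max_left _ _) (le_max_left _ _)) hN
  have hN2 : n₂ ≤ N := le_trans (le_trans (le_max_right _ _) (le_max_left _ _)) hN
  have hN3 : n₃ ≤ N := le_trans (le_trans (le_max_left _ _) (le_max_right _ _)) hN
  have hNtwo : 2 ≤ N := le_trans (le_trans (le_max_right _ _) (le_max_right _ _)) hN
  have hNone : 1 ≤ N := by omega
  have hNpos : (0 : ℝ) < N := by exact_mod_cast hNone
  -- the junta data of the linear bells
  set T : Fin N → Finset (Fin N) := fun k => suppOff W (r k) ∪ W with hTdef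
  have hT : ∀ k, (T k \ W).card ≤ (Nat.log 2 N) ^ C := fun k =>
    (card_le_card (sdiff_suppOff_union_subset W (r k))).trans (hr k)
  have hH : ∀ k (v : Fin R → ZMod 3) (x x' : Fin N → Bool), (∀ i ∈ T k, x i = x' i) →
      F k v (linVal (r k) x) = F k v (linVal (r k) x') := fun k v x x' hxx' => by
    rw [linVal_readsOnly W (r k) x x' hxx']
  set L : ℕ := Nat.log 2 N with hL
  set P : (Fin R → ZMod 3) → (Fin N → Bool) → Prop := fun v x =>
    OddZeros x ∧ RingHLF.Rel x (fun k => F k v (linVal (r k) x)) with hP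
  set Bj : Fin R → ℝ := fun j => (N : ℝ) ^ A * ρ ^ (α * (j.val + 1) + α * (A + 1) * L) * (2 : ℝ) ^ N with hBj
  have hBj0 : ∀ j, 0 ≤ Bj j := fun j => by positivity
  -- (a) main term: frozen seed residues give a `W`-tolerant polylog-junta strategy (`coverPolylogHard`)
  have ha : ∀ v : Fin R → ZMod 3,
      ∑ x : Fin N → Bool, (if P v x then (1 : ℝ) else 0) ≤ θ * (2 : ℝ) ^ (N - 1) := by
    intro v
    have h := hn₁ N hN1 W T (fun k x => F k v (linVal (r k) x)) hW hT (fun k => fun x x' hxx' => hH k v x x' hxx')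
    rw [sum_boole]
    simpa [AffBells22.winCount, hP] using h
  -- (b) graded twisted sums: `TwistedLinBoundX3S` applied to the frozen-seed linear bells
  have hb : ∀ (v γ : Fin R → ZMod 3) (j : Fin R), IsTop γ j →
      ‖∑ x : Fin N → Bool, (ZMod.stdAddChar (∑ i, γ i * LinForms.resVec c x i) : ℂ) *
          ((if P v x then (1 : ℝ) else 0 : ℝ) : ℂ)‖ ≤ Bj j := by
    intro v γ j hj
    set β : Fin N → ZMod 3 := fun m => ∑ i, γ i * c i m with hβ
    have hres : ∀ x : Fin N → Bool, ∑ i, γ i * LinForms.resVec c x i = ∑ m, if x m then β m else 0 := by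
      intro x
      simp only [LinForms.resVec, hβ, mul_sum]
      rw [sum_comm]
      refine sum_congr rfl fun m _ => ?_
      split_ifs <;> simp
    have h := hn₂ N hN2 W r (fun k t => F k v t) hW hr β
    have hcast : ∀ x : Fin N → Bool, (((if P v x then (1 : ℝ) else 0 : ℝ)) : ℂ) = (if P v x then (1 : ℂ) else 0) := by
      intro x; split_ifs <;> simp
    simp_rw [hres, hcast]
    refine le_trans (by simpa [hP] using h) ?_
    have hLC : 0 < L ^ C := by
      have hL1 : 1 ≤ L := by rw [hL]; exact Nat.le_log_of_pow_le (by norm_num) (by simpa using hNtwo)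
      exact pow_pos (by omega) C
    have hw0 : L ^ C * (α * (j.val + 1) + α * (A + 1) * L) ≤ (suppOff W β).card := hspread γ j hj
    have hw : α * (j.val + 1) + α * (A + 1) * L ≤ (suppOff W β).card / L ^ C := by
      rw [Nat.le_div_iff_mul_le hLC, mul_comm]; exact hw0
    calc (N : ℝ) ^ A * ρ ^ ((suppOff W β).card / L ^ C) * (2 : ℝ) ^ N
        ≤ (N : ℝ) ^ A * ρ ^ (α * (j.val + 1) + α * (A + 1) * L) * (2 : ℝ) ^ N := by
          gcongr _ * ?_ * _
          exact pow_le_pow_of_le_one hρ hρ1 hw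
      _ = Bj j := rfl
  -- the graded expansion
  have hmain := sum_le_max_add_graded (p := 3) (fun x : Fin N → Bool => LinForms.resVec c x)
    (fun v x => if P v x then (1 : ℝ) else 0) (θ * (2 : ℝ) ^ (N - 1)) Bj hBj0 ha hb
  have hset : ((univ.filter fun x : Fin N → Bool =>
      OddZeros x ∧ RingHLF.Rel x (fun k => F k (LinForms.resVec c x) (linVal (r k) x))).card : ℝ)
      = ∑ x : Fin N → Bool, (if P (LinForms.resVec c x) x then (1 : ℝ) else 0) := by
    rw [sum_boole]
  rw [hset]
  refine hmain.trans ?_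
  -- (c) the error term `Σ_j 3^{j+1} Bj j ≤ ((1-θ)/2)·2^{N-1}`
  have herr : ∑ j : Fin R, ((3 : ℕ) : ℝ) ^ (j.val + 1) * Bj j ≤ ((1 - θ) / 2) * (2 : ℝ) ^ (N - 1) := by
    have hterm : ∀ j : Fin R, ((3 : ℕ) : ℝ) ^ (j.val + 1) * Bj j =
        (3 * ρ ^ α) ^ (j.val + 1) * ((N : ℝ) ^ A * (ρ ^ α) ^ ((A + 1) * L) * (2 : ℝ) ^ N) := by
      intro j
      have e1 : ρ ^ (α * (j.val + 1) + α * (A + 1) * L) = (ρ ^ α) ^ (j.val + 1) * (ρ ^ α) ^ ((A + 1) * L) := by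
        rw [pow_add, pow_mul, mul_assoc, pow_mul]
      have eB : Bj j = (N : ℝ) ^ A * ρ ^ (α * (j.val + 1) + α * (A + 1) * L) * (2 : ℝ) ^ N := rfl
      rw [eB, e1, mul_pow]; push_cast; ring
    rw [sum_congr rfl fun j _ => hterm j, ← sum_mul]
    have hN2 : (2 : ℝ) ^ N = 2 * (2 : ℝ) ^ (N - 1) := by
      rw [← pow_succ']; congr 1; omega
    have hgeo := sum_pow_succ_le_div (3 * ρ ^ α) hq0 hq R
    have hdec := pow_mul_decay_le N A hNone (ρ ^ α) hρα0 hρα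
    have hq1 : 0 < 1 - 3 * ρ ^ α := by linarith
    have hK0 : 0 ≤ 3 * ρ ^ α / (1 - 3 * ρ ^ α) := div_nonneg hq0 hq1.le
    have hp : (0 : ℝ) ≤ (2 : ℝ) ^ (N - 1) := by positivity
    have hN3' : (2 : ℝ) ^ (A + 2) * (3 * ρ ^ α / (1 - 3 * ρ ^ α)) / ((1 - θ) / 2) ≤ N :=
      hn₃.trans (by exact_mod_cast hN3)
    have hkey : (2 : ℝ) ^ (A + 2) * (3 * ρ ^ α / (1 - 3 * ρ ^ α)) / N ≤ (1 - θ) / 2 := by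
      rw [div_le_iff₀ hNpos]
      rw [div_le_iff₀ h1θ] at hN3'
      linarith
    calc (∑ j : Fin R, (3 * ρ ^ α) ^ (j.val + 1)) * ((N : ℝ) ^ A * (ρ ^ α) ^ ((A + 1) * L) * (2 : ℝ) ^ N)
        ≤ (3 * ρ ^ α / (1 - 3 * ρ ^ α)) * ((2 : ℝ) ^ (A + 1) / N * (2 : ℝ) ^ N) := by
          refine mul_le_mul hgeo ?_ (by positivity) hK0
          exact mul_le_mul_of_nonneg_right hdec (by positivity)
      _ = ((2 : ℝ) ^ (A + 2) * (3 * ρ ^ α / (1 - 3 * ρ ^ α)) / N) * (2 : ℝ) ^ (N - 1) := by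
          rw [hN2]; ring
      _ ≤ ((1 - θ) / 2) * (2 : ℝ) ^ (N - 1) := mul_le_mul_of_nonneg_right hkey hp
  have h3 : ∑ j : Fin R, ((3 : ℕ) : ℝ) ^ (j.val + 1) * Bj j = ∑ j : Fin R, (3 : ℝ) ^ (j.val + 1) * Bj j := by
    push_cast; rfl
  linarith [herr]

end ReductionS

open scoped Classical in
/-- **Instantiation to per-output forms** (the `(J3)_{r=1}` structured branch, ROUND-37 §3 / Lemma S): outputs
`G k (⟨ℓ_k, x⟩)` with `ℓ_k = Σ_j a k j • c_j + r_k`, `c` graded-spread outside `W` (inflated schedule), `#(supp r_k ∖ W) ≤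
(log₂N)^C`, win on `≤ θ·2^{N−1}` odd inputs — given (R1-lin) for some `ρ` with `3ρ^α < 1`. -/
theorem perOutputForms_seedSparse {ρ : ℝ} {α : ℕ} (hρ : 0 ≤ ρ) (hq : 3 * ρ ^ α < 1) (hR1 : TwistedLinBoundX3S ρ) :
    ∃ θ : ℝ, θ < 1 ∧ ∀ C : ℕ, ∃ D n₀ : ℕ, ∀ N ≥ n₀,
      ∀ (W : Finset (Fin N)) (R : ℕ) (c : Fin R → Fin N → ZMod 3) (a : Fin N → Fin R → ZMod 3)
        (r : Fin N → Fin N → ZMod 3) (G : Fin N → ZMod 3 → Bool),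
        3 * W.card ≤ N → GradedSpreadOff W c (fun j => (Nat.log 2 N) ^ C * (α * (j.val + 1) + D * Nat.log 2 N)) →
        (∀ k, (suppOff W (r k)).card ≤ (Nat.log 2 N) ^ C) →
          ((univ.filter fun x : Fin N → Bool =>
              OddZeros x ∧ RingHLF.Rel x (fun k => G k (∑ j, a k j * LinForms.resVec c x j + linVal (r k) x))).card : ℝ)
            ≤ θ * (2 : ℝ) ^ (N - 1) := by
  classical
  obtain ⟨θ, hθ, hall⟩ := gradedLinReductionS ρ α hρ hq hR1
  refine ⟨θ, hθ, fun C => ?_⟩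
  obtain ⟨D, n₀, hD⟩ := hall C
  refine ⟨D, n₀, fun N hN W R c a r G hW hspread hr => ?_⟩
  exact hD N hN W R c r (fun k v t => G k (∑ j, a k j * v j + t)) hW hspread hr

end LinJunta39

end Summit.QuantumAdvantage.AdviceFreeQNC0

end
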